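import Literature.ModelTheory.ExponentialFields.ExpPolyJacobian
import HarnessLib

/-!
# Wilkie's desingularisation theorem for flat exponential polynomials (named fact)

Family `periods` (periods.S27), topic `Literature/ModelTheory/ExponentialFields`: leaf (B2) of the
decomposition of the conditional half of Macintyre–Wilkie's theorem
(`Literature.ModelTheory.ExponentialFields.macintyreWilkie_existential_of_schanuelProperty`).

Jones–Servi 2011 (transposing Macintyre–Wilkie 1996, §5), proof of Thm. 3.11: "By
[Wilkie96, Theorem 5.1] there exist `F ∈ (M_n(ℤ[α])[x̄⁻¹])ⁿ` and `ā ∈ ℝⁿ` such that `g(ā) = 0`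
and `ā ∈ V^{reg}(F)`" — every zero set of a function of the Noetherian differential ring `M_n`
contains a non-singular zero of a *square* system from `M_n`, in the **same** `n` variables.
The theorem invoked is Wilkie's desingularisation theorem for Noetherian rings of definable smooth
functions closed under differentiation (Wilkie, J. Amer. Math. Soc. 9 (1996); in the exposition of
den Besten, *Wilkie's Theorem and the Uniform Real Schanuel Conjecture*, MSc thesis Utrecht 2016,
it is **Theorem 3.3.4**: "Suppose that `K ⊨ T_A`. Let `n ≥ 1` and let `U ⊆ Kⁿ` be a nonempty
definable open set. Suppose that `M` is a Noetherian subring of `D_U` which contains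
`ℤ[x₁, …, xₙ]` and is closed under differentiation. Let `f ∈ M` and suppose that `S ⊆ V(f)` is
nonempty and definable and is furthermore open in the space `V(f)` and closed in `Kⁿ`. Then there
exist `f₁, …, fₙ ∈ M` such that `S ∩ V_r(f₁, …, fₙ) ≠ ∅`" — `V_r` denoting the non-singular
common zeros).

This file vendors the **special case** used by the decision procedure, as a named fact:
`K = ℝ` (the standard model of `T_A = Th(ℝ_exp)`), `U = ℝᴺ`, `M = ℤ[x̄, e^{x̄}]` — the ring of
flat integer exponential polynomials `x̄ ↦ P(x̄, e^{x̄})`, `P ∈ ℤ[x₁…x_N, y₁…y_N]`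
(`ExpPoly.expEval`, `ExpPolyJacobian.lean`): it is a homomorphic image of the Noetherian ring
`ℤ[x̄, ȳ]`, contains the polynomials, consists of functions definable in `ℝ_exp`, and is closed
under `∂/∂xᵢ` (`ExpPoly.expPD`: `∂ₖ[P(x̄, e^{x̄})] = (∂_{xₖ}P + yₖ ∂_{yₖ}P)(x̄, e^{x̄})`) — and
`S = V(f)` (closed, and open in itself):

* `Literature.ModelTheory.ExponentialFields.Wilkie1996_flatDesingularisation` (named fact): for `N ≥ 1` and
  `f ∈ ℤ[x̄, ȳ]` such that `x̄ ↦ f(x̄, e^{x̄})` has a real zero, there are `f₁, …, f_N ∈ ℤ[x̄, ȳ]`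
  and a common real zero `ā` of `f, f₁, …, f_N` (as functions `x̄ ↦ P(x̄, e^{x̄})`) at which the
  Jacobian of `(f₁, …, f_N)` (`ExpPoly.expJac`) is invertible.

The precise locator inside Wilkie's JAMS paper is pending its acquisition (acq-00515); the
statement above is quoted from den Besten's exposition (in the literature store) and from
Jones–Servi's use of it.  Not proved here (its 2-page proof — maximal ideals of points in the
Noetherian ring, Lagrange multipliers and the implicit function theorem — is a later discharge).

## References

* A. J. Wilkie, *Model completeness results for expansions of the ordered field of real numbers by
  restricted Pfaffian functions and the exponential function*, J. Amer. Math. Soc. 9 (1996),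
  1051–1094, Thm. 5.1 (as cited by Jones–Servi).
* M. den Besten, *Wilkie's Theorem and the Uniform Real Schanuel Conjecture*, MSc thesis, Utrecht
  (2016), Thm. 3.3.4 and Lemma 6.1.3.
* G. O. Jones, T. Servi, *On the decidability of the real field with a generic power function*,
  J. Symb. Log. 76 (2011), Thm. 3.11 (proof).
-/

noncomputable section

open scoped BigOperators Matrix

namespace Literature.ModelTheory.ExponentialFields

/-- **Wilkie's desingularisation theorem, flat integer exponential polynomials over `ℝ`**
(Wilkie, JAMS 9 (1996), Thm. 5.1 as cited by Jones–Servi 2011, proof of Thm. 3.11; den Besten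
2016, Thm. 3.3.4 with `K = ℝ`, `U = ℝᴺ`, `M = ℤ[x̄, e^{x̄}]`, `S = V(f)`): if `N ≥ 1` and the flat
exponential polynomial `x̄ ↦ f(x̄, e^{x̄})`, `f ∈ ℤ[x₁…x_N, y₁…y_N]`, has a zero in `ℝᴺ`, then its
zero set contains a non-singular common zero of some `f₁, …, f_N ∈ ℤ[x̄, ȳ]` (evaluated at
`(x̄, e^{x̄})`): a point `ā` with `f(ā, e^{ā}) = 0`, `fᵢ(ā, e^{ā}) = 0` for all `i`, and
`det (∂[fᵢ(x̄, e^{x̄})]/∂xⱼ)(ā) ≠ 0`. A named fact (`def … : Prop`), not yet proved here. [cite: WilkieJAMS1996, Thm. 5.1 (as cited by Jones–Servi 2011, proof of Thm. 3.11; = den Besten 2016, Thm. 3.3.4, case K = ℝ, M = ℤ[x̄, e^x̄], S = V(f))] -/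
def Wilkie1996_flatDesingularisation : Prop :=
  ∀ (N : ℕ), 1 ≤ N → ∀ f : MvPolynomial (Fin N ⊕ Fin N) ℤ,
    (∃ x : Fin N → ℝ, ExpPoly.expEval f x = 0) →
      ∃ (g : Fin N → MvPolynomial (Fin N ⊕ Fin N) ℤ) (a : Fin N → ℝ),
        ExpPoly.expEval f a = 0 ∧ (∀ i, ExpPoly.expEval (g i) a = 0) ∧ (ExpPoly.expJac g a).det ≠ 0

/-- The case `N = 0` needs no theorem: a zero of `f` is the empty tuple, at which the empty system
is non-singular (`det` of the `0 × 0` matrix is `1`). So the named fact yields the conclusion for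
every `N`. [folklore] -/
theorem flatDesingularisation_all (h : Wilkie1996_flatDesingularisation) (N : ℕ)
    (f : MvPolynomial (Fin N ⊕ Fin N) ℤ) (hf : ∃ x : Fin N → ℝ, ExpPoly.expEval f x = 0) :
    ∃ (g : Fin N → MvPolynomial (Fin N ⊕ Fin N) ℤ) (a : Fin N → ℝ),
      ExpPoly.expEval f a = 0 ∧ (∀ i, ExpPoly.expEval (g i) a = 0) ∧ (ExpPoly.expJac g a).det ≠ 0 := by
  rcases Nat.eq_zero_or_pos N with rfl | hN
  · obtain ⟨x, hx⟩ := hf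
    exact ⟨Fin.elim0, x, hx, fun i => i.elim0, by simp [Matrix.det_isEmpty]⟩
  · exact h N hN f hf

end Literature.ModelTheory.ExponentialFields

end
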